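import Summits.Ventures.Crystal3D.Theorems.StickyWulffConstantTextureLiminfFluxCountSel
import Summits.Ventures.Crystal3D.Theorems.StickyWulffConstantGenericWallFloorBarlowOrientedGlueOneSidedAt
import HarnessLib

/-!
# The flux count for an UP-presented plate along ANY e-upward step sequence (chosen-slot selectors)
# (lane T, crux `TextureLiminfV5`, stmt-Ventures-23912; cf-p1 ruling 2026-08-29T03:15:18Z (a): wulff-p2 owns the selector predicate)

HONEST FRAMING. Venture `Summits/Ventures/Crystal3D` (cell `crystal3d-full`), route `route-Ventures-StickyWulffConstant`, helper
`--supports` the law-v5 crux `TextureLiminfV5` (stmt-Ventures-23912).  Measure-theoretic bookkeeping, standard axioms; nothing about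
any wall law is claimed; rung F-C1 not moved.

THE CHEAPER SHAPE.  `plate_lines_ge_flux_sel` (…FluxCountSel) is stated for `IsZigSelector L σ e step`, which pins the rise of every
step to `bilayerRise` (the best of the three up-slots); lane G's chosen-slot K1a (`barlow_hlines_oriented_oneSided_at`, 19480-p2 p692347)
produces instead a step sequence with `IsUpBond` steps, `step k = v` on Δ-bilayers and the capper rise on ∇-bilayers.  Typing shows that NO
new selector predicate is needed: the flux-count engine (`lintegral_weightedLength_le_card`) only uses that the steps are e-upward bonds of
an up-presented plate with rises in `[1/4, 1]`, and the flux it certifies for bilayer `i` is `√2·⟪step i, L⁻¹e⟫`.  So: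
* `zigVertexS_apply_two_of_upBond`, `volume_modelSlab_step_of_upBond` — the polyline height and the slab-as-integral-over-lines for an
  `IsUpBond` step sequence of an up-presented plate (`0 ≤ (L⁻¹e)₂`; from 19480-p2's `zigVertexS_mem_barlowLayer_of_upBond`);
* **`plate_lines_ge_flux_up`** — `Σ_i √2·⟪step i, L⁻¹e⟫ · vol(S ∩ slab_i) ≤ #T` for every finite `T` containing the h-lines of the
  polyline's lattice translates through the window below the slice (same window constants as `plate_lines_ge_flux_sel`), under
  `hup : ∀ k, IsUpBond L σ e k (step k)` and `hr : ∀ k, 1/4 ≤ ⟪step k, L⁻¹e⟫`.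
The T-side cell inequality for chosen-slot tables (`c i j ≤ √2·⟪step₁ i, L₁⁻¹e₃⟫ / 2`, i.e. `√2·⟪L₁v, e₃⟫/2` on Δ-bilayers and
`√2·bilayerRise/2` on ∇-bilayers) is the next file (`…LineCountGlueOneSidedUp`).
WHAT THIS IS NOT: not the walker family, not a stub; F-C1 not moved.
-/

noncomputable section

namespace Summit.Ventures.Crystal3D.Theorems

open MeasureTheory Set
open scoped ENNReal InnerProductSpace
open Literature.MathematicalPhysics.StatisticalMechanics (IsHaggSeq triangularVec₁ triangularVec₂ barlowPos barlowPos_apply_two)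
open Summit.Ventures.Crystal3D.Cruxes.TextureLiminf.TexShadow (E3 stacking laySlab)

/-! ## The polyline of an `IsUpBond` step sequence (up-presented plate) -/

/-- The model height of vertex `k` of the polyline of an `IsUpBond` step sequence of an up-presented plate: `k·√(2/3)`. -/
theorem zigVertexS_apply_two_of_upBond (L : E3 ≃ₗᵢ[ℝ] E3) {σ : ℤ → ℤ} (hσ : IsHaggSeq σ) (e : E3) (hax : 0 ≤ (L.symm e) 2)
    {step : ℤ → E3} (hup : ∀ k : ℤ, IsUpBond L σ e k (step k)) (k : ℤ) :
    zigVertexS step k 2 = (k : ℝ) * Real.sqrt (2 / 3) := by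
  obtain ⟨x, y, h⟩ := zigVertexS_mem_barlowLayer_of_upBond L hσ e hax hup k
  rw [h, barlowPos_apply_two]

/-- In the cell, the lattice translates of the polyline vertices are plate sites: `L (zigVertexS k + t₀u + t₁v) + s ∈ stacking L s σ`. -/
theorem zigVertexS_add_lattice_mem_stacking_of_upBond (L : E3 ≃ₗᵢ[ℝ] E3) {σ : ℤ → ℤ} (hσ : IsHaggSeq σ) (e : E3)
    (hax : 0 ≤ (L.symm e) 2) {step : ℤ → E3} (hup : ∀ k : ℤ, IsUpBond L σ e k (step k)) (s : E3) (k : ℤ) (t : Fin 2 → ℤ) :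
    L (zigVertexS step k + ((t 0 : ℝ) • triangularVec₁ 1 + (t 1 : ℝ) • triangularVec₂ 1)) + s ∈ stacking L s σ := by
  obtain ⟨x, y, h⟩ := zigVertexS_mem_barlowLayer_of_upBond L hσ e hax hup k
  refine ⟨_, ⟨k, x + t 0, y + t 1, ?_⟩, rfl⟩
  rw [h]
  simp only [barlowPos]
  push_cast
  module

/-- **The model slab traversed at step `k`, as an integral over the lines** (up-presented plate, `IsUpBond` steps). -/
theorem volume_modelSlab_step_of_upBond {σ : ℤ → ℤ} (hσ : IsHaggSeq σ) (L : E3 ≃ₗᵢ[ℝ] E3) (e : E3) (hax : 0 ≤ (L.symm e) 2)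
    {step : ℤ → E3} (hup : ∀ k : ℤ, IsUpBond L σ e k (step k)) (S' : Set E3) (hS' : MeasurableSet S') (k : ℤ) :
    volume (S' ∩ {r : E3 | (k : ℝ) * Real.sqrt (2 / 3) < r 2 ∧ r 2 < ((k : ℝ) + 1) * Real.sqrt (2 / 3)}) =
      ENNReal.ofReal (Real.sqrt 3 / 2 * Real.sqrt (2 / 3)) *
        ∫⁻ x : Fin 2 → ℝ, volume {τ : ℝ | zigChart' (zigVertexS step k) (step k) (τ, x) ∈ S' ∧ 0 < τ ∧ τ < 1} := by
  have hB0 : 0 < Real.sqrt (2 / 3) := Real.sqrt_pos.2 (by norm_num)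
  have hΓ2 := zigVertexS_apply_two_of_upBond L hσ e hax hup k
  have hax1 : axisSign L e = 1 := by simp [axisSign, hax]
  have hD2 : step k 2 = Real.sqrt (2 / 3) := by rw [(hup k).apply_two, hax1, one_mul]
  have hD : 0 < step k 2 := by rw [hD2]; exact hB0
  have hslab : {r : E3 | (k : ℝ) * Real.sqrt (2 / 3) < r 2 ∧ r 2 < ((k : ℝ) + 1) * Real.sqrt (2 / 3)} =
      {w : E3 | zigVertexS step k 2 < w 2 ∧ w 2 < zigVertexS step k 2 + step k 2} := by
    ext w; rw [hΓ2, hD2]; constructor <;> rintro ⟨h1, h2⟩ <;> constructor <;> linarith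
  rw [hslab, volume_inter_laySlab_eq_lintegral_zigChart _ _ hD S' hS', hD2]

/-! ## The flux count along an `IsUpBond` step sequence -/

/-- **The flux count of a clamped, UP-presented Barlow plate along any e-upward step sequence.**  For `hup : ∀ k, IsUpBond L σ e k (step k)`
with rises `⟪step k, L⁻¹e⟫ ≥ 1/4`, a measurable slice `S` of finite volume inside `{z₁ ≤ ⟪p,e⟫ ≤ z₁+1} ∩ cyl ρ'`, and a finite set `T`
of lattice labels containing every label whose line through some polyline vertex lies in the window
`H ≤ ⟪·,e⟫ ≤ H+1`, lateral `≤ ρ' + 4 + 4(z₁ + 4 − H)` (`H + 1 ≤ z₁ − 3`):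
`Σ_i √2·⟪step i, L⁻¹e⟫ · vol(S ∩ laySlab L s i) ≤ #T`. -/
theorem plate_lines_ge_flux_up {σ : ℤ → ℤ} (hσ : IsHaggSeq σ) (L : E3 ≃ₗᵢ[ℝ] E3) (s e : E3) (he : ‖e‖ = 1)
    (hax : 0 ≤ (L.symm e) 2) {step : ℤ → E3} (hup : ∀ k : ℤ, IsUpBond L σ e k (step k))
    (hr : ∀ k : ℤ, (1 / 4 : ℝ) ≤ ⟪step k, L.symm e⟫_ℝ)
    (ρ' z₁ H : ℝ) (hH : H + 1 ≤ z₁ - 3) (S : Set E3) (hSm : MeasurableSet S) (hSfin : volume S ≠ ⊤)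
    (hS : S ⊆ {p : E3 | z₁ ≤ ⟪p, e⟫_ℝ ∧ ⟪p, e⟫_ℝ ≤ z₁ + 1 ∧ Real.sqrt (p 0 ^ 2 + p 1 ^ 2) ≤ ρ'})
    (T : Finset (Fin 2 → ℤ))
    (hT : ∀ t : Fin 2 → ℤ, (∃ k : ℤ,
        H ≤ ⟪L (zigVertexS step k + ((t 0 : ℝ) • triangularVec₁ 1 + (t 1 : ℝ) • triangularVec₂ 1)) + s, e⟫_ℝ ∧
        ⟪L (zigVertexS step k + ((t 0 : ℝ) • triangularVec₁ 1 + (t 1 : ℝ) • triangularVec₂ 1)) + s, e⟫_ℝ ≤ H + 1 ∧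
        Real.sqrt ((L (zigVertexS step k + ((t 0 : ℝ) • triangularVec₁ 1 + (t 1 : ℝ) • triangularVec₂ 1)) + s) 0 ^ 2 +
          (L (zigVertexS step k + ((t 0 : ℝ) • triangularVec₁ 1 + (t 1 : ℝ) • triangularVec₂ 1)) + s) 1 ^ 2) ≤
          ρ' + 4 + 4 * (z₁ + 4 - H)) → t ∈ T) :
    ∑' i : ℤ, (Real.sqrt 2 * ⟪step i, L.symm e⟫_ℝ) * (volume (S ∩ laySlab L s i)).toReal ≤ (T.card : ℝ) := by
  classical
  -- the polyline and its rises
  set ν : E3 := L.symm e with hν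
  have hνn : ‖ν‖ = 1 := by rw [hν, LinearIsometryEquiv.norm_map, he]
  set Γ : ℤ → E3 := zigVertexS step with hΓ
  have hΓD : ∀ k, Γ (k + 1) - Γ k = step k := fun k => by rw [hΓ, zigVertexS_succ]; abel
  have hn1 : ∀ k, ‖step k‖ = 1 := fun k => (hup k).norm_eq_one
  have hrk1 : ∀ k, ⟪step k, ν⟫_ℝ ≤ 1 := fun k =>
    (real_inner_le_norm _ _).trans (by rw [hn1, hνn, one_mul])
  have hr' : ∀ k, (1 / 4 : ℝ) ≤ ⟪Γ (k + 1) - Γ k, ν⟫_ℝ := fun k => by rw [hΓD]; exact hr k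
  have hr1 : ∀ k, ⟪Γ (k + 1) - Γ k, ν⟫_ℝ ≤ 1 := fun k => by rw [hΓD]; exact hrk1 k
  have hD : ∀ k, ‖Γ (k + 1) - Γ k‖ ≤ 1 := fun k => by rw [hΓD, hn1]
  -- the model slice and the lateral gauge
  set S' : Set E3 := (fun w => L w + s) ⁻¹' S with hS'
  have hcont : Continuous fun w : E3 => L w + s := L.continuous.add continuous_const
  have hS'm : MeasurableSet S' := hcont.measurable hSm
  set lat : E3 → ℝ := fun w => Real.sqrt ((L w + s) 0 ^ 2 + (L w + s) 1 ^ 2) with hlat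
  have hlat_sub : ∀ w y : E3, lat (w + y) ≤ lat w + ‖y‖ := by
    intro w y
    have h := sqrt_lateral_add_le (L w + s) (L y)
    rw [LinearIsometryEquiv.norm_map] at h
    have heq : L (w + y) + s = L w + s + L y := by rw [map_add]; abel
    simp only [hlat, heq]; exact h
  have hheight : ∀ w : E3, ⟪L w + s, e⟫_ℝ = ⟪w, ν⟫_ℝ + ⟪s, e⟫_ℝ := fun w => by
    rw [inner_add_left, hν, ← LinearIsometryEquiv.inner_map_map L w (L.symm e), LinearIsometryEquiv.apply_symm_apply]
  have hS'sub : S' ⊆ {w : E3 | z₁ - ⟪s, e⟫_ℝ ≤ ⟪w, ν⟫_ℝ ∧ ⟪w, ν⟫_ℝ ≤ z₁ - ⟪s, e⟫_ℝ + 1 ∧ lat w ≤ ρ'} := by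
    intro w hw
    obtain ⟨h1, h2, h3⟩ := hS hw
    rw [hheight] at h1 h2
    exact ⟨by linarith, by linarith, h3⟩
  -- the line count
  have hcount := lintegral_weightedLength_le_card ν hνn lat hlat_sub Γ (1 / 4) (by norm_num) hr' hr1 hD
    (z₁ - ⟪s, e⟫_ℝ) ρ' (H - ⟪s, e⟫_ℝ) (by linarith) S' hS'sub T (fun t ⟨k, hk1, hk2, hk3⟩ => by
      refine hT t ⟨k, ?_⟩
      have hV : zigChart' (Γ k) 0 (0, fun i => (t i : ℝ)) =
          zigVertexS step k + ((t 0 : ℝ) • triangularVec₁ 1 + (t 1 : ℝ) • triangularVec₂ 1) := by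
        rw [zigChart'_zero, hΓ]; abel
      rw [hV] at hk1 hk2 hk3
      rw [hheight]
      refine ⟨by linarith, by linarith, ?_⟩
      have : (z₁ - ⟪s, e⟫_ℝ + 4 - (H - ⟪s, e⟫_ℝ)) / (1 / 4) = 4 * (z₁ + 4 - H) := by ring
      rw [this] at hk3; exact hk3)
  -- the left-hand side as an integral over the lines
  set ℓ : ℤ → (Fin 2 → ℝ) → ℝ≥0∞ := fun k x =>
    volume {τ : ℝ | zigChart' (Γ k) (Γ (k + 1) - Γ k) (τ, x) ∈ S' ∧ 0 < τ ∧ τ < 1} with hℓ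
  have hℓmeas : ∀ k, Measurable (ℓ k) := by
    intro k
    have hA : MeasurableSet {p : ℝ × (Fin 2 → ℝ) | zigChart' (Γ k) (Γ (k + 1) - Γ k) p ∈ S' ∧ 0 < p.1 ∧ p.1 < 1} := by
      have h1 : MeasurableSet (zigChart' (Γ k) (Γ (k + 1) - Γ k) ⁻¹' S') := (continuous_zigChart' _ _).measurable hS'm
      have h2 : MeasurableSet {p : ℝ × (Fin 2 → ℝ) | 0 < p.1} := measurableSet_lt measurable_const measurable_fst
      have h3 : MeasurableSet {p : ℝ × (Fin 2 → ℝ) | p.1 < 1} := measurableSet_lt measurable_fst measurable_const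
      have : {p : ℝ × (Fin 2 → ℝ) | zigChart' (Γ k) (Γ (k + 1) - Γ k) p ∈ S' ∧ 0 < p.1 ∧ p.1 < 1} =
          (zigChart' (Γ k) (Γ (k + 1) - Γ k) ⁻¹' S') ∩ {p | 0 < p.1} ∩ {p | p.1 < 1} := by
        ext p; simp [and_assoc]
      rw [this]; exact (h1.inter h2).inter h3
    exact measurable_measure_prodMk_right hA
  have hLHS : ∑' i : ℤ, ENNReal.ofReal (Real.sqrt 2 * ⟪step i, ν⟫_ℝ) * volume (S ∩ laySlab L s i) =
      ∫⁻ x : Fin 2 → ℝ, ∑' k : ℤ, ENNReal.ofReal ⟪Γ (k + 1) - Γ k, ν⟫_ℝ * ℓ k x := by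
    rw [lintegral_tsum fun k => ((hℓmeas k).const_mul _).aemeasurable]
    refine tsum_congr fun k => ?_
    rw [volume_inter_laySlab_eq_model L s S hSm, volume_modelSlab_step_of_upBond hσ L e hax hup S' hS'm k]
    have hrk : 0 ≤ ⟪step k, ν⟫_ℝ := by linarith [hr k]
    have hprod : Real.sqrt 2 * ⟪step k, ν⟫_ℝ * (Real.sqrt 3 / 2 * Real.sqrt (2 / 3)) = ⟪step k, ν⟫_ℝ := by
      rw [mul_comm (Real.sqrt 2), mul_assoc, sqrt_two_mul_det, mul_one]
    rw [← mul_assoc, ← ENNReal.ofReal_mul (mul_nonneg (Real.sqrt_nonneg _) hrk), hprod,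
      lintegral_const_mul _ (hℓmeas k)]
    have hΓD' : zigVertexS step (k + 1) - zigVertexS step k = step k := by rw [zigVertexS_succ]; abel
    simp only [hℓ, hΓ, hν, hΓD']
  have henn : ∑' i : ℤ, ENNReal.ofReal (Real.sqrt 2 * ⟪step i, ν⟫_ℝ) * volume (S ∩ laySlab L s i) ≤ (T.card : ℝ≥0∞) := by
    rw [hLHS]; exact hcount
  -- back to the reals
  have hfin : ∀ i, volume (S ∩ laySlab L s i) ≠ ⊤ := fun i => ne_top_of_le_ne_top hSfin (measure_mono Set.inter_subset_left)
  have hpf0 : ∀ i, 0 ≤ Real.sqrt 2 * ⟪step i, ν⟫_ℝ := fun i =>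
    mul_nonneg (Real.sqrt_nonneg _) (le_trans (by norm_num) (hr i))
  have hreal : ∑' i : ℤ, (Real.sqrt 2 * ⟪step i, ν⟫_ℝ) * (volume (S ∩ laySlab L s i)).toReal =
      (∑' i : ℤ, ENNReal.ofReal (Real.sqrt 2 * ⟪step i, ν⟫_ℝ) * volume (S ∩ laySlab L s i)).toReal := by
    rw [ENNReal.tsum_toReal_eq fun i => ENNReal.mul_ne_top ENNReal.ofReal_ne_top (hfin i)]
    refine tsum_congr fun i => ?_
    rw [ENNReal.toReal_mul, ENNReal.toReal_ofReal (hpf0 i)]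
  rw [hreal]
  have := ENNReal.toReal_mono (ENNReal.natCast_ne_top T.card) henn
  simpa using this

end Summit.Ventures.Crystal3D.Theorems

end
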